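import Summits.ABC.ABC.Theorems.FeketeScalesSubmultOfRST
import Literature.Barriers.ABC.EpsilonCannotBeDroppedProofs

/-!
# `SubmultOfRST`, bridge from Robert–Stewart–Tenenbaum's Conjecture A (upper half)

Route `FeketeScales` (ABC/ABC); companion of `FeketeScalesSubmultOfRST.lean` (item stmt-ABC-10340), kept in a
separate file so that the route's own cone does not import the barrier catalogue.

The item's docstring records that its inline hypothesis — a sub-power slack
`c < rad · exp(A (log rad)^τ)` with `τ < 1` — is implied by the named open conjecture
`Literature.Barriers.ABC.RSTConjectureAUpper` (Robert–Stewart–Tenenbaum 2014, Conjecture A (1·5)):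
since `log₂ k, log₃ k ≥ 1` and `log₃ k ≤ log₂ k`, `rstExponent C₁ k ≤ 4√3 (3/2 + |C₁|) √(log k)`
(`Literature.Barriers.ABC.rstExponent_le`), i.e. `τ = 1/2`, `A = 4√3 (3/2 + |C₁|)`.  This file proves
that bridge (`SubmultOfRST.subpowerSlack_of_rstConjectureAUpper`) and the resulting conditional
statement `RSTConjectureAUpper → ScaleSubmultiplicativity` (the crux of rank 2 sits below RST's refined
conjecture), which was the earlier form (stmt-ABC-2162) of the item.

Sources: [RobertStewartTenenbaum2014, Conjecture A, §1]; the route file's docstring for stmt-ABC-10340.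
-/

-- `Summit.<Summit>.<Problem>` is the mandated summit-side namespace (CONVENTIONS §2); for the
-- single-conjunct summit `ABC` the two coincide, so the duplicate `ABC.ABC` is deliberate.
set_option linter.dupNamespace false

namespace Summit.ABC.ABC.Theorems

open Literature.NumberTheory.DiophantineGeometry Literature.Barriers.ABC

/-- Robert–Stewart–Tenenbaum's Conjecture A, upper half, implies the sub-power slack hypothesis of
`SubmultOfRST` with `τ = 1/2` and `A = 4√3 (3/2 + |C₁|)`:
`c < k e^{rstExponent C₁ k} ≤ k e^{A (log k)^{1/2}}`, `k = rad(abc) ≥ 1`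
[cite: RobertStewartTenenbaum2014, Conjecture A, §1]. -/
theorem SubmultOfRST.subpowerSlack_of_rstConjectureAUpper (h : RSTConjectureAUpper) :
    ∃ τ : ℝ, τ < 1 ∧ ∃ A : ℝ, ∀ a b c : ℕ, IsABCTriple a b c →
      (c : ℝ) < ((rad a b c : ℕ) : ℝ) * Real.exp (A * Real.log ((rad a b c : ℕ) : ℝ) ^ τ) := by
  obtain ⟨C₁, hC₁⟩ := h
  refine ⟨1 / 2, by norm_num, 4 * Real.sqrt 3 * (3 / 2 + |C₁|), ?_⟩
  intro a b c habc
  have hk1 : (1 : ℝ) ≤ ((rad a b c : ℕ) : ℝ) := by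
    exact_mod_cast Nat.succ_le_of_lt (Nat.radical_pos _)
  have hle : rstExponent C₁ ((rad a b c : ℕ) : ℝ) ≤
      4 * Real.sqrt 3 * (3 / 2 + |C₁|) * Real.log ((rad a b c : ℕ) : ℝ) ^ (1 / 2 : ℝ) := by
    rw [← Real.sqrt_eq_rpow]
    exact rstExponent_le C₁ hk1
  calc (c : ℝ) < ((rad a b c : ℕ) : ℝ) * Real.exp (rstExponent C₁ ((rad a b c : ℕ) : ℝ)) :=
        hC₁ a b c habc
    _ ≤ ((rad a b c : ℕ) : ℝ) *
          Real.exp (4 * Real.sqrt 3 * (3 / 2 + |C₁|) * Real.log ((rad a b c : ℕ) : ℝ) ^ (1 / 2 : ℝ)) :=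
        mul_le_mul_of_nonneg_left (Real.exp_le_exp.mpr hle) (Nat.cast_nonneg _)

/-- **Model-consistency of the rank-2 crux** (earlier form stmt-ABC-2162 of item `SubmultOfRST`):
Robert–Stewart–Tenenbaum's Conjecture A, upper half (1·5), implies `ScaleSubmultiplicativity` — by the
bridge above and `submultOfRST_proof` (stmt-ABC-10340).  CONDITIONAL on the open conjecture
`RSTConjectureAUpper`, taken as a hypothesis [cite: RobertStewartTenenbaum2014, Conjecture A, §1]. -/
theorem SubmultOfRST.scaleSubmultiplicativity_of_rstConjectureAUpper (h : RSTConjectureAUpper) :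
    Summit.ABC.ABC.Theses.FeketeScales.ScaleSubmultiplicativity :=
  submultOfRST_proof (SubmultOfRST.subpowerSlack_of_rstConjectureAUpper h)

end Summit.ABC.ABC.Theorems
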